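import Summits.Parity.GeneralizedHardyLittlewood.Theorems.LeeYangFibresRelativeDimOneDefs
import HarnessLib

/-!
# Route `LeeYangFibres`, crux `RelativeDimOne` (stmt-Parity-14113), line `SketchIdeator1` =
`translate-amplification`: real-variable bookkeeping of the transfer `stub_amplification`

Sorry-free auxiliary facts for `LeeYangFibresRelativeDimOneAmplification.lean`, which proves the
registered stub `stub_amplification : Amplification`
(`CompleteSum → SingularMean → DegenerateCount → CoarseHLSlack → RelativeDimOne`, the tensor-power
trick over translate-constellations). Everything here is elementary real analysis / finite sums,
kept apart so that the main file stays short: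

* `exists_abs_le_mul_of_tendsto_div` — from `g(T)/T → 0`: `|g(T)| ≤ c T` for all large `T`;
* `exp_le_pow_of_abs_le` — `|x| ≤ n log a` gives `e^x ≤ a^n` and `(a^n)⁻¹ ≤ e^{-x}`;
* `exists_log_pow_le_mul`, `exists_degenerate_tail_le` — `log^T(cN) = o(N)`
  (Mathlib `Real.isLittleO_pow_log_id_atTop`), so the few degenerate shifts
  (`≤ C (4N+1)^{m-1}` of them, each of weight `≤ (2N+1) log^T(2LN)`) contribute `o(N^{m+1})`;
* `card_shiftBox`, `card_shiftBox_real_le` — `#[-2N,2N]^m = (4N+1)^m ≤ 5^m N^m`;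
* `upper_ratio` (registered sub-goal), `lower_ratio` — `(1+e/4)^{m+1}(1+e/10) ≤ (1+e/2)^{m+1}` and
  `(1-e/2)^{m+1}(1+e/4)^{m+1} ≤ 1 - 3e/40` for `0 ≤ e ≤ 1`;
* `sum_filter_upper`, `sum_filter_lower` — a sum split along a predicate, with per-term bounds;
* `high_mass_amplify` — THE BOOKKEEPING AT HIGH SINGULAR MASS: from the complete-sum identity
  `∑_H S_H = S^{m+1}`, the averaged main terms `∑_{good H} M_H = M^{m+1} + O(ε₅(M^{m+1} + N^{m+1}))`,
  the two-sided coarse bounds `A⁻¹ M_H - η'N ≤ S_H ≤ A M_H + η'N` on the good shifts, the trivial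
  bound on the `o(N^{m+1})`-many bad shifts and `k N^{m+1} ≤ M^{m+1}`, with the parameter choice
  `ε₅ = e k/40`, `η' = e k/(40 A 5^m)` and `A (1+e/10) ≤ (1+e/2)^{m+1}`,
  `(1-e/2)^{m+1} A ≤ 1 - 3e/40`: `((1-e/2)M)^{m+1} ≤ S^{m+1} ≤ ((1+e/2)M)^{m+1}`, hence
  `|S - M| ≤ (e/2) M` by monotonicity of `x ↦ x^{m+1}` on `ℝ≥0`.
-/

noncomputable section

open scoped BigOperators Classical Topology
open Finset Filter Literature.NumberTheory.Sieve

namespace Summit.Parity.GeneralizedHardyLittlewood.Cruxes.RelativeDimOne.TranslateAmplification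

/-! ### Limits and exponentials -/

/-- From `g(T)/T → 0`: for every `c > 0`, `|g(T)| ≤ c T` for all large `T`. -/
theorem exists_abs_le_mul_of_tendsto_div {g : ℕ → ℝ}
    (hg : Tendsto (fun T : ℕ => g T / T) atTop (𝓝 0)) {c : ℝ} (hc : 0 < c) :
    ∃ M₀ : ℕ, ∀ T : ℕ, M₀ ≤ T → |g T| ≤ c * T := by
  obtain ⟨M₀, hM₀⟩ := Metric.tendsto_atTop.mp hg c hc
  refine ⟨max M₀ 1, fun T hT => ?_⟩
  have hT1 : 1 ≤ T := le_trans (le_max_right _ _) hT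
  have hT0 : (0 : ℝ) < T := by exact_mod_cast hT1
  have h := hM₀ T (le_trans (le_max_left _ _) hT)
  rw [Real.dist_0_eq_abs, abs_div, Nat.abs_cast, div_lt_iff₀ hT0] at h
  exact h.le

/-- `|x| ≤ n log a` (`a > 0`) gives `e^x ≤ a^n` and `(a^n)⁻¹ ≤ e^{-x}`. -/
theorem exp_le_pow_of_abs_le {x a : ℝ} {n : ℕ} (ha : 0 < a) (h : |x| ≤ (n : ℝ) * Real.log a) :
    Real.exp x ≤ a ^ n ∧ (a ^ n)⁻¹ ≤ Real.exp (-x) := by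
  have h1 : Real.exp ((n : ℝ) * Real.log a) = a ^ n := by
    rw [Real.exp_nat_mul, Real.exp_log ha]
  refine ⟨?_, ?_⟩
  · rw [← h1]
    exact Real.exp_le_exp.mpr ((le_abs_self x).trans h)
  · rw [← h1, ← Real.exp_neg]
    exact Real.exp_le_exp.mpr (by linarith [le_abs_self x])

/-- `log^T(cN) ≤ δ N` for all large `N` (`log^T = o(id)`, Mathlib `Real.isLittleO_pow_log_id_atTop`). -/
theorem exists_log_pow_le_mul (T : ℕ) {c δ : ℝ} (hc : 0 < c) (hδ : 0 < δ) :
    ∃ N₀ : ℕ, ∀ N : ℕ, N₀ ≤ N → Real.log (c * N) ^ T ≤ δ * N := by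
  have h := (Real.isLittleO_pow_log_id_atTop (n := T)).bound (div_pos hδ hc)
  have ht : Tendsto (fun N : ℕ => c * (N : ℝ)) atTop atTop :=
    Tendsto.const_mul_atTop hc tendsto_natCast_atTop_atTop
  obtain ⟨N₀, hN₀⟩ := eventually_atTop.mp (ht.eventually h)
  refine ⟨N₀, fun N hN => ?_⟩
  have h3 := hN₀ N hN
  have hcN : 0 ≤ c * N := by positivity
  simp only [id, Real.norm_eq_abs, abs_of_nonneg hcN] at h3
  calc Real.log (c * N) ^ T ≤ |Real.log (c * N) ^ T| := le_abs_self _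
    _ ≤ δ / c * (c * N) := h3
    _ = δ * N := by rw [← mul_assoc, div_mul_cancel₀ δ hc.ne']

/-- The degenerate shifts contribute `o(N^{m+1})`: for `m ≥ 1`, `C ≥ 0`, `L ≥ 1`, `ν > 0` and all
large `N ≥ 1`, `C (4N+1)^{m-1} · (2N+1) log^T(2LN) ≤ ν N^{m+1}`. -/
theorem exists_degenerate_tail_le (m T : ℕ) (hm : 1 ≤ m) {C L ν : ℝ} (hC : 0 ≤ C) (hL : 1 ≤ L)
    (hν : 0 < ν) :
    ∃ N₀ : ℕ, ∀ N : ℕ, N₀ ≤ N → 1 ≤ N →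
      C * ((4 * N + 1 : ℕ) : ℝ) ^ (m - 1) * ((2 * N + 1) * Real.log (2 * L * N) ^ T) ≤
        ν * (N : ℝ) ^ (m + 1) := by
  have hδ : 0 < ν / (C * 5 ^ m + 1) := by positivity
  obtain ⟨N₀, hN₀⟩ := exists_log_pow_le_mul T (c := 2 * L) (by linarith) hδ
  refine ⟨N₀, fun N hN hN1 => ?_⟩
  have hlog := hN₀ N hN
  have hN1' : (1 : ℝ) ≤ N := by exact_mod_cast hN1
  have hlog0 : 0 ≤ Real.log (2 * L * N) := Real.log_nonneg (by nlinarith)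
  have h4 : ((4 * N + 1 : ℕ) : ℝ) ^ (m - 1) ≤ (5 * (N : ℝ)) ^ (m - 1) :=
    pow_le_pow_left₀ (by positivity) (by push_cast; linarith) _
  have h2 : (2 * (N : ℝ) + 1) * Real.log (2 * L * N) ^ T ≤ 5 * N * (ν / (C * 5 ^ m + 1) * N) :=
    mul_le_mul (by linarith) hlog (pow_nonneg hlog0 _) (by positivity)
  have h5 : (5 * (N : ℝ)) ^ (m - 1) * (5 * N) = 5 ^ m * (N : ℝ) ^ m := by
    rw [pow_sub_one_mul (by omega) (5 * (N : ℝ)), mul_pow]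
  have hfrac : C * 5 ^ m * (ν / (C * 5 ^ m + 1)) ≤ ν := by
    rw [← mul_div_assoc, div_le_iff₀ (by positivity)]
    nlinarith
  calc C * ((4 * N + 1 : ℕ) : ℝ) ^ (m - 1) * ((2 * N + 1) * Real.log (2 * L * N) ^ T)
      ≤ C * (5 * (N : ℝ)) ^ (m - 1) * (5 * N * (ν / (C * 5 ^ m + 1) * N)) :=
        mul_le_mul (mul_le_mul_of_nonneg_left h4 hC) h2
          (mul_nonneg (by positivity) (pow_nonneg hlog0 _)) (by positivity)
    _ = C * 5 ^ m * (ν / (C * 5 ^ m + 1)) * (N : ℝ) ^ (m + 1) := by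
        calc C * (5 * (N : ℝ)) ^ (m - 1) * (5 * N * (ν / (C * 5 ^ m + 1) * N))
            = C * ((5 * (N : ℝ)) ^ (m - 1) * (5 * N)) * (ν / (C * 5 ^ m + 1)) * N := by ring
          _ = C * 5 ^ m * (ν / (C * 5 ^ m + 1)) * (N : ℝ) ^ (m + 1) := by rw [h5]; ring
    _ ≤ ν * (N : ℝ) ^ (m + 1) := mul_le_mul_of_nonneg_right hfrac (by positivity)

/-! ### The shift box -/

/-- `#([-2N, 2N]^m ∩ ℤ^m) = (4N+1)^m`. -/
theorem card_shiftBox (m N : ℕ) : (shiftBox m N).card = (4 * N + 1) ^ m := by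
  rw [shiftBox, Fintype.card_piFinset, Finset.prod_const, Finset.card_univ, Fintype.card_fin,
    Int.card_Icc]
  congr 1
  omega

/-- `#([-2N, 2N]^m ∩ ℤ^m) ≤ 5^m N^m` for `N ≥ 1`, over `ℝ`. -/
theorem card_shiftBox_real_le (m : ℕ) {N : ℕ} (hN : 1 ≤ N) :
    ((shiftBox m N).card : ℝ) ≤ 5 ^ m * (N : ℝ) ^ m := by
  rw [card_shiftBox]
  have hN1 : (1 : ℝ) ≤ N := by exact_mod_cast hN
  push_cast
  rw [← mul_pow]
  exact pow_le_pow_left₀ (by positivity) (by linarith) _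

/-! ### Elementary inequalities for the `(m+1)`-th root extraction -/

/-- `(1+e/4)^{m+1} (1+e/10) ≤ (1+e/2)^{m+1}` for `0 ≤ e ≤ 1` (as `(1+e/4)(1+e/10) ≤ 1+e/2`);
the registered sub-goal of this auxiliary file. -/
theorem upper_ratio : ∀ (m : ℕ) (e : ℝ), 0 ≤ e → e ≤ 1 → (1 + e / 4) ^ (m + 1) * (1 + e / 10) ≤ (1 + e / 2) ^ (m + 1) := by
  intro m e he0 he1
  have h1 : 1 + e / 10 ≤ (1 + e / 10) ^ (m + 1) := le_self_pow₀ (by linarith) (Nat.succ_ne_zero m)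
  calc (1 + e / 4) ^ (m + 1) * (1 + e / 10)
      ≤ (1 + e / 4) ^ (m + 1) * (1 + e / 10) ^ (m + 1) :=
        mul_le_mul_of_nonneg_left h1 (by positivity)
    _ = ((1 + e / 4) * (1 + e / 10)) ^ (m + 1) := (mul_pow _ _ _).symm
    _ ≤ (1 + e / 2) ^ (m + 1) := pow_le_pow_left₀ (by positivity) (by nlinarith) _

/-- `(1-e/2)^{m+1} (1+e/4)^{m+1} ≤ 1 - 3e/40` for `0 ≤ e ≤ 1` (as `(1-e/2)(1+e/4) ≤ 1 - e/4 ≤ 1`). -/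
theorem lower_ratio (m : ℕ) {e : ℝ} (he0 : 0 ≤ e) (he1 : e ≤ 1) :
    (1 - e / 2) ^ (m + 1) * (1 + e / 4) ^ (m + 1) ≤ 1 - 3 * e / 40 := by
  rw [← mul_pow]
  have h0 : 0 ≤ (1 - e / 2) * (1 + e / 4) := mul_nonneg (by linarith) (by linarith)
  have h1 : (1 - e / 2) * (1 + e / 4) ≤ 1 - e / 4 := by nlinarith
  calc ((1 - e / 2) * (1 + e / 4)) ^ (m + 1) ≤ (1 - e / 4) ^ (m + 1) := pow_le_pow_left₀ h0 h1 _
    _ ≤ 1 - e / 4 := pow_le_of_le_one (by linarith) (by linarith) (Nat.succ_ne_zero m)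
    _ ≤ 1 - 3 * e / 40 := by linarith

/-! ### Splitting a sum along a predicate -/

/-- Upper bound for `∑_s S` from per-term bounds on the good (`p`) and the bad (`¬p`) terms. -/
theorem sum_filter_upper {ι : Type*} (s : Finset ι) (p : ι → Prop) [DecidablePred p]
    (S M : ι → ℝ) {A θ B : ℝ} (hG : ∀ H ∈ s, p H → S H ≤ A * M H + θ)
    (hD : ∀ H ∈ s, ¬p H → S H ≤ B) :
    ∑ H ∈ s, S H ≤ A * ∑ H ∈ s.filter p, M H + (s.filter p).card * θ +
      (s.filter (fun H => ¬p H)).card * B := by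
  rw [← Finset.sum_filter_add_sum_filter_not s p S]
  have h1 : ∑ H ∈ s.filter p, S H ≤ ∑ H ∈ s.filter p, (A * M H + θ) :=
    Finset.sum_le_sum fun H hH => hG H (Finset.mem_filter.mp hH).1 (Finset.mem_filter.mp hH).2
  have h2 : ∑ H ∈ s.filter (fun H => ¬p H), S H ≤ ∑ _H ∈ s.filter (fun H => ¬p H), B :=
    Finset.sum_le_sum fun H hH => hD H (Finset.mem_filter.mp hH).1 (Finset.mem_filter.mp hH).2
  rw [Finset.sum_add_distrib, ← Finset.mul_sum, Finset.sum_const, nsmul_eq_mul] at h1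
  rw [Finset.sum_const, nsmul_eq_mul] at h2
  linarith

/-- Lower bound for `∑_s S` from per-term lower bounds on the good terms and `S ≥ 0` on all terms. -/
theorem sum_filter_lower {ι : Type*} (s : Finset ι) (p : ι → Prop) [DecidablePred p]
    (S M : ι → ℝ) {A θ : ℝ} (hG : ∀ H ∈ s, p H → A * M H - θ ≤ S H) (h0 : ∀ H ∈ s, 0 ≤ S H) :
    A * ∑ H ∈ s.filter p, M H - (s.filter p).card * θ ≤ ∑ H ∈ s, S H := by
  rw [← Finset.sum_filter_add_sum_filter_not s p S]
  have h1 : ∑ H ∈ s.filter p, (A * M H - θ) ≤ ∑ H ∈ s.filter p, S H :=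
    Finset.sum_le_sum fun H hH => hG H (Finset.mem_filter.mp hH).1 (Finset.mem_filter.mp hH).2
  have h2 : 0 ≤ ∑ H ∈ s.filter (fun H => ¬p H), S H :=
    Finset.sum_nonneg fun H hH => h0 H (Finset.mem_filter.mp hH).1
  rw [Finset.sum_sub_distrib, ← Finset.mul_sum, Finset.sum_const, nsmul_eq_mul] at h1
  linarith

/-! ### The tensor-power bookkeeping at high singular mass -/

/-- HIGH SINGULAR MASS (`k N^{m+1} ≤ M^{m+1}`, i.e. `κ N ≤ M` with `k = κ^{m+1}`). Over a finite set
`s` of shifts split into good (`p`) and bad ones: if `∑_s S_H = S^{m+1}` (complete sum),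
`|∑_{good} M_H - M^{m+1}| ≤ ε₅ (M^{m+1} + N^{m+1})` (averaged main terms),
`A⁻¹ M_H - η' N ≤ S_H ≤ A M_H + η' N` on good shifts (coarse two-sided bounds, `A ≥ 1`),
`0 ≤ S_H ≤ B` with `#bad · B ≤ CD · B ≤ ε₅ N^{m+1}` (few bad shifts), `#s ≤ 5^m N^m`, and the
parameters are `ε₅ = e k/40`, `η' = e k/(40 A 5^m)` with `A(1 + e/10) ≤ (1+e/2)^{m+1}` and
`(1-e/2)^{m+1} A ≤ 1 - 3e/40`, then `((1-e/2)M)^{m+1} ≤ S^{m+1} ≤ ((1+e/2)M)^{m+1}`, whence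
`|S - M| ≤ (e/2) M` by monotonicity of `x ↦ x^{m+1}` on `ℝ≥0`. -/
theorem high_mass_amplify {ι : Type*} (s : Finset ι) (p : ι → Prop) [DecidablePred p]
    (SH MH : ι → ℝ) (m : ℕ) {N : ℕ} {S M A e k ε₅ η' CD B : ℝ}
    (hA : 1 ≤ A) (he0 : 0 ≤ e) (he1 : e ≤ 1) (hS : 0 ≤ S) (hM : 0 ≤ M)
    (hk0 : 0 ≤ k) (hk1 : k ≤ 1) (hkM : k * (N : ℝ) ^ (m + 1) ≤ M ^ (m + 1))
    (hε₅ : ε₅ = e * k / 40) (hη' : η' = e * k / (40 * A * 5 ^ m))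
    (hX : ∑ H ∈ s, SH H = S ^ (m + 1))
    (hSig : |∑ H ∈ s.filter p, MH H - M ^ (m + 1)| ≤ ε₅ * (M ^ (m + 1) + (N : ℝ) ^ (m + 1)))
    (hGup : ∀ H ∈ s, p H → SH H ≤ A * MH H + η' * N)
    (hGlo : ∀ H ∈ s, p H → A⁻¹ * MH H - η' * N ≤ SH H)
    (hDup : ∀ H ∈ s, ¬p H → SH H ≤ B) (hB : 0 ≤ B) (h0 : ∀ H ∈ s, 0 ≤ SH H)
    (hcard : (s.card : ℝ) ≤ 5 ^ m * (N : ℝ) ^ m)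
    (hcardD : ((s.filter (fun H => ¬p H)).card : ℝ) ≤ CD)
    (htail : CD * B ≤ ε₅ * (N : ℝ) ^ (m + 1))
    (hAup : A * (1 + e / 10) ≤ (1 + e / 2) ^ (m + 1))
    (hAlo : (1 - e / 2) ^ (m + 1) * A ≤ 1 - 3 * e / 40) :
    |S - M| ≤ e / 2 * M := by
  have hA0 : 0 < A := by linarith
  have hP0 : 0 ≤ M ^ (m + 1) := pow_nonneg hM _
  have hη'0 : 0 ≤ η' := by rw [hη']; positivity
  -- the complete sum, split along `p`
  have hup := sum_filter_upper s p SH MH hGup hDup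
  have hlo := sum_filter_lower s p SH MH hGlo h0
  rw [hX] at hup hlo
  have hcardG : ((s.filter p).card : ℝ) ≤ 5 ^ m * (N : ℝ) ^ m :=
    le_trans (by exact_mod_cast Finset.card_filter_le s p) hcard
  have hGslack : ((s.filter p).card : ℝ) * (η' * N) ≤ 5 ^ m * η' * (N : ℝ) ^ (m + 1) :=
    calc ((s.filter p).card : ℝ) * (η' * N) ≤ 5 ^ m * (N : ℝ) ^ m * (η' * N) :=
          mul_le_mul_of_nonneg_right hcardG (by positivity)
      _ = 5 ^ m * η' * (N : ℝ) ^ (m + 1) := by rw [pow_succ]; ring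
  have hDpart : ((s.filter (fun H => ¬p H)).card : ℝ) * B ≤ ε₅ * (N : ℝ) ^ (m + 1) :=
    (mul_le_mul_of_nonneg_right hcardD hB).trans htail
  have hXup : S ^ (m + 1) ≤
      A * ∑ H ∈ s.filter p, MH H + 5 ^ m * η' * (N : ℝ) ^ (m + 1) + ε₅ * (N : ℝ) ^ (m + 1) := by
    linarith
  have hXlo : A⁻¹ * ∑ H ∈ s.filter p, MH H - 5 ^ m * η' * (N : ℝ) ^ (m + 1) ≤ S ^ (m + 1) := by
    linarith
  -- the parameters against `k N^{m+1} ≤ M^{m+1}`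
  have hθ : A * (5 ^ m * η' * (N : ℝ) ^ (m + 1)) ≤ e / 40 * M ^ (m + 1) := by
    have h1 : A * (5 ^ m * η' * (N : ℝ) ^ (m + 1)) = e / 40 * (k * (N : ℝ) ^ (m + 1)) := by
      rw [hη']
      field_simp
    rw [h1]
    exact mul_le_mul_of_nonneg_left hkM (by positivity)
  have hε₅Q : ε₅ * (N : ℝ) ^ (m + 1) ≤ e / 40 * M ^ (m + 1) := by
    have h1 : ε₅ * (N : ℝ) ^ (m + 1) = e / 40 * (k * (N : ℝ) ^ (m + 1)) := by rw [hε₅]; ring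
    rw [h1]
    exact mul_le_mul_of_nonneg_left hkM (by positivity)
  have hε₅P : ε₅ * M ^ (m + 1) ≤ e / 40 * M ^ (m + 1) := by
    refine mul_le_mul_of_nonneg_right ?_ hP0
    rw [hε₅]
    have h1 : e * k ≤ e := by nlinarith
    linarith
  obtain ⟨hSiglo, hSigup⟩ := abs_le.mp hSig
  have hSigup' : ∑ H ∈ s.filter p, MH H ≤ (1 + e / 20) * M ^ (m + 1) := by linarith
  have hSiglo' : (1 - e / 20) * M ^ (m + 1) ≤ ∑ H ∈ s.filter p, MH H := by linarith
  -- UPPER: `S^{m+1} ≤ A (1 + e/10) M^{m+1} ≤ ((1 + e/2) M)^{m+1}`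
  have hAP : M ^ (m + 1) ≤ A * M ^ (m + 1) := le_mul_of_one_le_left hP0 hA
  have heAP : e / 40 * M ^ (m + 1) ≤ e / 40 * (A * M ^ (m + 1)) :=
    mul_le_mul_of_nonneg_left hAP (by positivity)
  have hθQ : 5 ^ m * η' * (N : ℝ) ^ (m + 1) ≤ e / 40 * M ^ (m + 1) :=
    le_trans (le_mul_of_one_le_left (by positivity) hA) hθ
  have hASig : A * ∑ H ∈ s.filter p, MH H ≤ A * ((1 + e / 20) * M ^ (m + 1)) :=
    mul_le_mul_of_nonneg_left hSigup' hA0.le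
  have hU : S ^ (m + 1) ≤ ((1 + e / 2) * M) ^ (m + 1) := by
    have h1 : S ^ (m + 1) ≤ A * (1 + e / 10) * M ^ (m + 1) := by linarith
    have h2 : A * (1 + e / 10) * M ^ (m + 1) ≤ (1 + e / 2) ^ (m + 1) * M ^ (m + 1) :=
      mul_le_mul_of_nonneg_right hAup hP0
    rw [mul_pow]
    linarith
  -- LOWER: `S^{m+1} ≥ A⁻¹ (1 - 3e/40) M^{m+1} ≥ ((1 - e/2) M)^{m+1}`
  have hL : ((1 - e / 2) * M) ^ (m + 1) ≤ S ^ (m + 1) := by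
    have hθQ' : 5 ^ m * η' * (N : ℝ) ^ (m + 1) ≤ A⁻¹ * (e / 40 * M ^ (m + 1)) := by
      rw [← inv_mul_cancel_left₀ hA0.ne' (5 ^ m * η' * (N : ℝ) ^ (m + 1))]
      exact mul_le_mul_of_nonneg_left hθ (inv_nonneg.mpr hA0.le)
    have hASig' : A⁻¹ * ((1 - e / 20) * M ^ (m + 1)) ≤ A⁻¹ * ∑ H ∈ s.filter p, MH H :=
      mul_le_mul_of_nonneg_left hSiglo' (inv_nonneg.mpr hA0.le)
    have h1 : A⁻¹ * (1 - 3 * e / 40) * M ^ (m + 1) ≤ S ^ (m + 1) := by linarith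
    have h2 : (1 - e / 2) ^ (m + 1) ≤ A⁻¹ * (1 - 3 * e / 40) := by
      rw [inv_mul_eq_div, le_div_iff₀ hA0]
      exact hAlo
    have h3 : (1 - e / 2) ^ (m + 1) * M ^ (m + 1) ≤ A⁻¹ * (1 - 3 * e / 40) * M ^ (m + 1) :=
      mul_le_mul_of_nonneg_right h2 hP0
    rw [mul_pow]
    linarith
  -- `(m+1)`-th roots
  have hm0 : m + 1 ≠ 0 := Nat.succ_ne_zero m
  have he2 : 0 ≤ 1 - e / 2 := by linarith
  have h1 : S ≤ (1 + e / 2) * M := (pow_le_pow_iff_left₀ hS (by positivity) hm0).mp hU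
  have h2 : (1 - e / 2) * M ≤ S := (pow_le_pow_iff_left₀ (mul_nonneg he2 hM) hS hm0).mp hL
  rw [abs_le]
  constructor <;> linarith

end Summit.Parity.GeneralizedHardyLittlewood.Cruxes.RelativeDimOne.TranslateAmplification
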